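import Literature.NumberTheory.Weil1964.ArchMetaplecticDoubleCover
import HarnessLib

/-!
# The Siegel upper half-space action of weil-1's `Sp(W)` and its automorphy factor (block algebra for Folland Thm. (4.37))

Topic `NumberTheory/Weil1964`; namespace `Literature.NumberTheory.Weil1964`.  KERNEL throughout: definitions with
bodies and proved theorems only — no records, no `sorry`, no cited hypothesis.

This is file 1 of 3 of the Schrödinger-model «Gaussian-orbit» proof of the two cited records R1
`Folland1989_Thm_4_37_ab` / R2 `Folland1989_Thm_4_37_c` of `ArchMetaplecticDoubleCover` (row B07-3 of the pub-hodgecm2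
literature fan-out).  It supplies the pure matrix algebra:

* §1 the four real block matrices `𝐀 𝐁 𝐂 𝐃` (`Sp.mA … Sp.mD`) of `g ∈ Sp(W)`, `W = ℝ^σ × ℝ^σ`,
  `g(p,q) = (𝐀p + 𝐁q, 𝐂p + 𝐃q)` (`Sp.apply_eq_blocks'`), the three symplectic relations
  `𝐀ᵀ𝐂 = 𝐂ᵀ𝐀`, `𝐁ᵀ𝐃 = 𝐃ᵀ𝐁`, `𝐀ᵀ𝐃 − 𝐂ᵀ𝐁 = 1` [Folland (4.2)], the blocks of `1`, of a product, of the generators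
  `m(a,d)`, `n(b)` and of the Weyl element `(p,q) ↦ (−q,p)`, and `2·P(g) = (𝐀 + 𝐃) + i(𝐂 − 𝐁)` (`Sp.follandP`);
* §2 the Siegel upper half-space `siegelH σ = {τ ∈ M_σ(ℂ) : τᵀ = τ, Im τ ≻ 0}` [Folland (4.62) / §5.4] and the bridge between
  real and complex positivity of `Im τ`;
* §3 the action that the SCHRÖDINGER-model generators induce on Gaussians `e^{πi x·τx}` — it is the Möbius action of
  `ᵗg⁻¹ = (𝐃 −𝐂; −𝐁 𝐀)`: `g ⋆ τ = (𝐃τ − 𝐂)(𝐀 − 𝐁τ)⁻¹` (`Sp.sact`), with automorphy factor `j(g,τ) = det(𝐀 − 𝐁τ)` (`Sp.sJ`):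
  the denominator is invertible and `g ⋆ τ ∈ 𝔥` (the classical `ᵗ(Cτ+D)N̄ − …` computation, `Sp.sact_mem`),
  `(gh) ⋆ τ = g ⋆ (h ⋆ τ)`, the cocycle `j(gh,τ) = j(g, h⋆τ) j(h,τ)`, the values on `1`, `m(a,d)` (`τ ↦ 𝐃τ𝐀⁻¹`, `j = det 𝐀`),
  `n(b)` (`τ ↦ τ − b`, `j = 1`), the Weyl element (`τ ↦ −τ⁻¹`, `j = det τ`);
* §4 the link with Folland's normalisation: `(1 − i(g⋆i))(𝐀 − i𝐁) = 2P(g)`, hence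
  `det(1 − i(g⋆i)) · j(g,i) = 2ⁿ det P(g)` (`Sp.det_one_sub_I_sact_mul_sJ`) — the identity that turns the
  Gaussian-orbit cocycle into `C² det P = 1` — and its corollary `det P(g) ≠ 0` (`Sp.follandP_det_ne_zero`).

## References

* [Folland1989] G. B. Folland, *Harmonic Analysis in Phase Space*, Princeton UP 1989, §4.1 Prop. (4.1)/(4.2) (symplectic
  block relations), (4.11)–(4.16) (`P`), §4.5 (4.62)–(4.65) (Siegel half-space, action, Gaussians), Thm. (4.37).
* [Siegel1943] C. L. Siegel, *Symplectic geometry*, Amer. J. Math. 65 (1943) 1–86, §§1–2 (the action on `𝔥ₙ`).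
-/

set_option autoImplicit false

noncomputable section

open Complex Matrix
open scoped ComplexOrder ComplexConjugate

namespace Literature.NumberTheory.Weil1964

open Literature.Analysis.SegalBargmann Literature.RepresentationTheory.HeisenbergGroup

variable {σ : Type*} [Fintype σ] [DecidableEq σ]

local notation "PV" σ => (σ → ℝ) × (σ → ℝ)
local notation "SpR" σ => symplecticGroup (polar (dotPairing σ))
/-- complexification of a real matrix -/
local notation "RC" => RingHom.mapMatrix (m := σ) Complex.ofRealHom

/-! ## 1. Block matrices of `g ∈ Sp(W)` and the symplectic relations -/

namespace Sp

/-- The matrix `𝐀` of the block `A` of `g`. [cite: Folland1989, §4.1 Prop. (4.1)] -/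
def mA (g : SpR σ) : Matrix σ σ ℝ := LinearMap.toMatrix' (blockA g)
/-- The matrix `𝐁` of the block `B` of `g`. [cite: Folland1989, §4.1 Prop. (4.1)] -/
def mB (g : SpR σ) : Matrix σ σ ℝ := LinearMap.toMatrix' (blockB g)
/-- The matrix `𝐂` of the block `C` of `g`. [cite: Folland1989, §4.1 Prop. (4.1)] -/
def mC (g : SpR σ) : Matrix σ σ ℝ := LinearMap.toMatrix' (blockC g)
/-- The matrix `𝐃` of the block `D` of `g`. [cite: Folland1989, §4.1 Prop. (4.1)] -/
def mD (g : SpR σ) : Matrix σ σ ℝ := LinearMap.toMatrix' (blockD g)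

/-- `𝐀 p = (g(p,0)).1`. [cite: Folland1989, §4.1 Prop. (4.1)] -/
theorem mA_mulVec (g : SpR σ) (p : σ → ℝ) : mA g *ᵥ p = ((g.1 : (PV σ) ≃ₗ[ℝ] PV σ) (p, 0)).1 := by
  rw [mA, LinearMap.toMatrix'_mulVec, blockA_apply]
/-- `𝐁 q = (g(0,q)).1`. [cite: Folland1989, §4.1 Prop. (4.1)] -/
theorem mB_mulVec (g : SpR σ) (q : σ → ℝ) : mB g *ᵥ q = ((g.1 : (PV σ) ≃ₗ[ℝ] PV σ) (0, q)).1 := by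
  rw [mB, LinearMap.toMatrix'_mulVec, blockB_apply]
/-- `𝐂 p = (g(p,0)).2`. [cite: Folland1989, §4.1 Prop. (4.1)] -/
theorem mC_mulVec (g : SpR σ) (p : σ → ℝ) : mC g *ᵥ p = ((g.1 : (PV σ) ≃ₗ[ℝ] PV σ) (p, 0)).2 := by
  rw [mC, LinearMap.toMatrix'_mulVec, blockC_apply]
/-- `𝐃 q = (g(0,q)).2`. [cite: Folland1989, §4.1 Prop. (4.1)] -/
theorem mD_mulVec (g : SpR σ) (q : σ → ℝ) : mD g *ᵥ q = ((g.1 : (PV σ) ≃ₗ[ℝ] PV σ) (0, q)).2 := by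
  rw [mD, LinearMap.toMatrix'_mulVec, blockD_apply]

/-- **`g(p,q) = (𝐀p + 𝐁q, 𝐂p + 𝐃q)`.** [cite: Folland1989, §4.1 Prop. (4.1)] -/
theorem apply_eq_blocks' (g : SpR σ) (p q : σ → ℝ) :
    (g.1 : (PV σ) ≃ₗ[ℝ] PV σ) (p, q) = (mA g *ᵥ p + mB g *ᵥ q, mC g *ᵥ p + mD g *ᵥ q) := by
  have h : ((p, q) : PV σ) = (p, 0) + (0, q) := by rw [Prod.mk_add_mk, add_zero, zero_add]
  rw [h, map_add, mA_mulVec, mB_mulVec, mC_mulVec, mD_mulVec]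
  rfl

omit [DecidableEq σ] in
/-- The symplectic form of `W`: `ω((p,q),(p',q')) = p·q' − p'·q` is preserved by `g`. [cite: Folland1989, §4.1 (4.2)] -/
theorem polar_sub_polar_eq (g : SpR σ) (w w' : PV σ) :
    ((g.1 : (PV σ) ≃ₗ[ℝ] PV σ) w).1 ⬝ᵥ ((g.1 : (PV σ) ≃ₗ[ℝ] PV σ) w').2 -
      ((g.1 : (PV σ) ≃ₗ[ℝ] PV σ) w').1 ⬝ᵥ ((g.1 : (PV σ) ≃ₗ[ℝ] PV σ) w).2 = w.1 ⬝ᵥ w'.2 - w'.1 ⬝ᵥ w.2 := by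
  have h := (mem_symplecticGroup (polar (dotPairing σ)) g.1).1 g.2 w w'
  simpa only [polar_apply, dotPairing_apply] using h

omit [DecidableEq σ] in
/-- `(Mp)·(Nq) = p·(MᵀN q)`. [folklore] -/
private theorem mulVec_dotProduct_mulVec (M N : Matrix σ σ ℝ) (p q : σ → ℝ) :
    (M *ᵥ p) ⬝ᵥ (N *ᵥ q) = p ⬝ᵥ ((Mᵀ * N) *ᵥ q) := by
  rw [← Matrix.mulVec_mulVec, Matrix.dotProduct_mulVec p Mᵀ, Matrix.vecMul_transpose]

/-- Two real matrices with the same bilinear form are equal. [folklore] -/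
private theorem eq_of_forall_dotProduct_mulVec_eq {M N : Matrix σ σ ℝ} (h : ∀ p q : σ → ℝ, p ⬝ᵥ (M *ᵥ q) = p ⬝ᵥ (N *ᵥ q)) :
    M = N := by
  have h' : (Matrix.toLinearMap₂' ℝ M : (σ → ℝ) →ₗ[ℝ] (σ → ℝ) →ₗ[ℝ] ℝ) = Matrix.toLinearMap₂' ℝ N := by
    refine LinearMap.ext fun p => LinearMap.ext fun q => ?_
    rw [Matrix.toLinearMap₂'_apply', Matrix.toLinearMap₂'_apply', h]
  exact (Matrix.toLinearMap₂' ℝ (S₁ := ℝ) (S₂ := ℝ) (N₂ := ℝ) (n := σ) (m := σ)).injective h'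

/-- **First symplectic relation `𝐀ᵀ𝐂 = 𝐂ᵀ𝐀`** (from `ω(g(p,0), g(p',0)) = 0`). [cite: Folland1989, §4.1 (4.2)] -/
theorem transpose_mA_mul_mC (g : SpR σ) : (mA g)ᵀ * mC g = (mC g)ᵀ * mA g := by
  refine eq_of_forall_dotProduct_mulVec_eq fun p p' => ?_
  have h := polar_sub_polar_eq g (p, 0) (p', 0)
  dsimp only at h
  rw [← mA_mulVec, ← mA_mulVec, ← mC_mulVec, ← mC_mulVec, dotProduct_zero, dotProduct_zero, sub_zero,
    sub_eq_zero, mulVec_dotProduct_mulVec, mulVec_dotProduct_mulVec, Matrix.dotProduct_mulVec p',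
    dotProduct_comm _ p, ← Matrix.mulVec_transpose, Matrix.transpose_mul, Matrix.transpose_transpose] at h
  exact h

/-- **Second symplectic relation `𝐁ᵀ𝐃 = 𝐃ᵀ𝐁`** (from `ω(g(0,q), g(0,q')) = 0`). [cite: Folland1989, §4.1 (4.2)] -/
theorem transpose_mB_mul_mD (g : SpR σ) : (mB g)ᵀ * mD g = (mD g)ᵀ * mB g := by
  refine eq_of_forall_dotProduct_mulVec_eq fun q q' => ?_
  have h := polar_sub_polar_eq g (0, q) (0, q')
  dsimp only at h
  rw [← mB_mulVec, ← mB_mulVec, ← mD_mulVec, ← mD_mulVec, zero_dotProduct, zero_dotProduct, sub_zero,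
    sub_eq_zero, mulVec_dotProduct_mulVec, mulVec_dotProduct_mulVec, Matrix.dotProduct_mulVec q',
    dotProduct_comm _ q, ← Matrix.mulVec_transpose, Matrix.transpose_mul, Matrix.transpose_transpose] at h
  exact h

/-- **Third symplectic relation `𝐀ᵀ𝐃 − 𝐂ᵀ𝐁 = 1`** (from `ω(g(p,0), g(0,q)) = p·q`). [cite: Folland1989, §4.1 (4.2)] -/
theorem transpose_mA_mul_mD_sub (g : SpR σ) : (mA g)ᵀ * mD g - (mC g)ᵀ * mB g = 1 := by
  refine eq_of_forall_dotProduct_mulVec_eq fun p q => ?_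
  have h := polar_sub_polar_eq g (p, 0) (0, q)
  dsimp only at h
  rw [← mA_mulVec, ← mB_mulVec, ← mC_mulVec, ← mD_mulVec, zero_dotProduct, sub_zero,
    mulVec_dotProduct_mulVec, mulVec_dotProduct_mulVec, Matrix.dotProduct_mulVec q ((mB g)ᵀ * mC g),
    dotProduct_comm _ p, ← Matrix.mulVec_transpose, Matrix.transpose_mul, Matrix.transpose_transpose] at h
  rw [Matrix.sub_mulVec, dotProduct_sub, Matrix.one_mulVec, h]

/-- Transposed third relation `𝐃ᵀ𝐀 − 𝐁ᵀ𝐂 = 1`. [cite: Folland1989, §4.1 (4.2)] -/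
theorem transpose_mD_mul_mA_sub (g : SpR σ) : (mD g)ᵀ * mA g - (mB g)ᵀ * mC g = 1 := by
  have h := congrArg Matrix.transpose (transpose_mA_mul_mD_sub g)
  rwa [Matrix.transpose_sub, Matrix.transpose_mul, Matrix.transpose_mul, Matrix.transpose_transpose,
    Matrix.transpose_transpose, Matrix.transpose_one] at h

/-! ### Blocks of `1`, of products, of the generators -/

/-- Blocks of `1`: `𝐀 = 𝐃 = 1`, `𝐁 = 𝐂 = 0`. [cite: Folland1989, §4.1 Prop. (4.1)] -/
theorem mA_one : mA (1 : SpR σ) = 1 := by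
  rw [mA]; exact (LinearMap.toMatrix'_id : LinearMap.toMatrix' (LinearMap.id : (σ → ℝ) →ₗ[ℝ] σ → ℝ) = 1)
/-- Blocks of `1`. [cite: Folland1989, §4.1 Prop. (4.1)] -/
theorem mB_one : mB (1 : SpR σ) = 0 := by
  rw [mB]
  have : blockB (1 : SpR σ) = 0 := LinearMap.ext fun q => rfl
  rw [this, map_zero]
/-- Blocks of `1`. [cite: Folland1989, §4.1 Prop. (4.1)] -/
theorem mC_one : mC (1 : SpR σ) = 0 := by
  rw [mC]
  have : blockC (1 : SpR σ) = 0 := LinearMap.ext fun q => rfl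
  rw [this, map_zero]
/-- Blocks of `1`. [cite: Folland1989, §4.1 Prop. (4.1)] -/
theorem mD_one : mD (1 : SpR σ) = 1 := by
  rw [mD]; exact (LinearMap.toMatrix'_id : LinearMap.toMatrix' (LinearMap.id : (σ → ℝ) →ₗ[ℝ] σ → ℝ) = 1)

/-- `(gh)(p,0)` through the blocks. [folklore] -/
private theorem mul_apply_inl (g h : SpR σ) (p : σ → ℝ) :
    ((g * h).1 : (PV σ) ≃ₗ[ℝ] PV σ) (p, 0) =
      (mA g *ᵥ (mA h *ᵥ p) + mB g *ᵥ (mC h *ᵥ p), mC g *ᵥ (mA h *ᵥ p) + mD g *ᵥ (mC h *ᵥ p)) := by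
  show (g.1 : (PV σ) ≃ₗ[ℝ] PV σ) ((h.1 : (PV σ) ≃ₗ[ℝ] PV σ) (p, 0)) = _
  rw [apply_eq_blocks' h, Matrix.mulVec_zero, Matrix.mulVec_zero, add_zero, add_zero, apply_eq_blocks' g]

/-- `(gh)(0,q)` through the blocks. [folklore] -/
private theorem mul_apply_inr (g h : SpR σ) (q : σ → ℝ) :
    ((g * h).1 : (PV σ) ≃ₗ[ℝ] PV σ) (0, q) =
      (mA g *ᵥ (mB h *ᵥ q) + mB g *ᵥ (mD h *ᵥ q), mC g *ᵥ (mB h *ᵥ q) + mD g *ᵥ (mD h *ᵥ q)) := by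
  show (g.1 : (PV σ) ≃ₗ[ℝ] PV σ) ((h.1 : (PV σ) ≃ₗ[ℝ] PV σ) (0, q)) = _
  rw [apply_eq_blocks' h, Matrix.mulVec_zero, Matrix.mulVec_zero, zero_add, zero_add, apply_eq_blocks' g]

omit [DecidableEq σ] in
/-- A real matrix is determined by its action on vectors. [folklore] -/
private theorem eq_of_forall_mulVec_eq {M N : Matrix σ σ ℝ} (h : ∀ v, M *ᵥ v = N *ᵥ v) : M = N := by
  classical
  rw [← Matrix.toLin'.injective.eq_iff]
  exact LinearMap.ext fun v => by rw [Matrix.toLin'_apply, Matrix.toLin'_apply, h]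

/-- **Blocks of a product**: `𝐀(gh) = 𝐀_g𝐀_h + 𝐁_g𝐂_h`. [cite: Folland1989, §4.1 Prop. (4.1)] -/
theorem mA_mul (g h : SpR σ) : mA (g * h) = mA g * mA h + mB g * mC h :=
  eq_of_forall_mulVec_eq fun p => by
    rw [mA_mulVec, mul_apply_inl]
    dsimp only
    rw [Matrix.add_mulVec, Matrix.mulVec_mulVec, Matrix.mulVec_mulVec]
/-- `𝐁(gh) = 𝐀_g𝐁_h + 𝐁_g𝐃_h`. [cite: Folland1989, §4.1 Prop. (4.1)] -/
theorem mB_mul (g h : SpR σ) : mB (g * h) = mA g * mB h + mB g * mD h :=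
  eq_of_forall_mulVec_eq fun q => by
    rw [mB_mulVec, mul_apply_inr]
    dsimp only
    rw [Matrix.add_mulVec, Matrix.mulVec_mulVec, Matrix.mulVec_mulVec]
/-- `𝐂(gh) = 𝐂_g𝐀_h + 𝐃_g𝐂_h`. [cite: Folland1989, §4.1 Prop. (4.1)] -/
theorem mC_mul (g h : SpR σ) : mC (g * h) = mC g * mA h + mD g * mC h :=
  eq_of_forall_mulVec_eq fun p => by
    rw [mC_mulVec, mul_apply_inl]
    dsimp only
    rw [Matrix.add_mulVec, Matrix.mulVec_mulVec, Matrix.mulVec_mulVec]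
/-- `𝐃(gh) = 𝐂_g𝐁_h + 𝐃_g𝐃_h`. [cite: Folland1989, §4.1 Prop. (4.1)] -/
theorem mD_mul (g h : SpR σ) : mD (g * h) = mC g * mB h + mD g * mD h :=
  eq_of_forall_mulVec_eq fun q => by
    rw [mD_mulVec, mul_apply_inr]
    dsimp only
    rw [Matrix.add_mulVec, Matrix.mulVec_mulVec, Matrix.mulVec_mulVec]

/-- Blocks of the Levi element `m(a,d) : (p,q) ↦ (ap, dq)`: `𝐀 = a`, `𝐁 = 𝐂 = 0`, `𝐃 = d`. [cite: Folland1989, §4.2 (4.24)] -/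
theorem blocks_leviSp (a d : (σ → ℝ) ≃ₗ[ℝ] (σ → ℝ)) (had : ∀ x y, dotPairing σ (a x) (d y) = dotPairing σ x y) :
    mA (leviSp (dotPairing σ) a d had) = LinearMap.toMatrix' a.toLinearMap ∧
      mB (leviSp (dotPairing σ) a d had) = 0 ∧ mC (leviSp (dotPairing σ) a d had) = 0 ∧
      mD (leviSp (dotPairing σ) a d had) = LinearMap.toMatrix' d.toLinearMap := by
  have hA : blockA (leviSp (dotPairing σ) a d had) = a.toLinearMap :=
    LinearMap.ext fun p => by simp [blockA_apply, coe_leviSp_apply]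
  have hB : blockB (leviSp (dotPairing σ) a d had) = 0 :=
    LinearMap.ext fun q => by simp [blockB_apply, coe_leviSp_apply]
  have hC : blockC (leviSp (dotPairing σ) a d had) = 0 :=
    LinearMap.ext fun p => by simp [blockC_apply, coe_leviSp_apply]
  have hD : blockD (leviSp (dotPairing σ) a d had) = d.toLinearMap :=
    LinearMap.ext fun q => by simp [blockD_apply, coe_leviSp_apply]
  refine ⟨?_, ?_, ?_, ?_⟩
  · rw [mA, hA]
  · rw [mB, hB, map_zero]
  · rw [mC, hC, map_zero]
  · rw [mD, hD]

/-- For a Levi pair, `aᵀ d = 1` (`a x · d y = x · y`). [cite: Folland1989, §4.2 (4.24)] -/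
theorem transpose_mul_eq_one_of_levi (a d : (σ → ℝ) ≃ₗ[ℝ] (σ → ℝ))
    (had : ∀ x y, dotPairing σ (a x) (d y) = dotPairing σ x y) :
    (LinearMap.toMatrix' a.toLinearMap)ᵀ * LinearMap.toMatrix' d.toLinearMap = 1 := by
  refine eq_of_forall_dotProduct_mulVec_eq fun p q => ?_
  rw [← mulVec_dotProduct_mulVec, LinearMap.toMatrix'_mulVec, LinearMap.toMatrix'_mulVec, Matrix.one_mulVec]
  exact had p q

/-- Blocks of the unipotent `n(b) : (p,q) ↦ (p, q + bp)`: `𝐀 = 𝐃 = 1`, `𝐁 = 0`, `𝐂 = b`. [cite: Folland1989, §4.2 (4.25)] -/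
theorem blocks_unipotentSp (b : (σ → ℝ) →ₗ[ℝ] (σ → ℝ)) (hb : ∀ x x', dotPairing σ x (b x') = dotPairing σ x' (b x)) :
    mA (unipotentSp (dotPairing σ) b hb) = 1 ∧ mB (unipotentSp (dotPairing σ) b hb) = 0 ∧
      mC (unipotentSp (dotPairing σ) b hb) = LinearMap.toMatrix' b ∧ mD (unipotentSp (dotPairing σ) b hb) = 1 := by
  have hA : blockA (unipotentSp (dotPairing σ) b hb) = LinearMap.id :=
    LinearMap.ext fun p => by simp [blockA_apply, coe_unipotentSp, unipotentσ_apply]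
  have hB : blockB (unipotentSp (dotPairing σ) b hb) = 0 :=
    LinearMap.ext fun q => by simp [blockB_apply, coe_unipotentSp, unipotentσ_apply]
  have hC : blockC (unipotentSp (dotPairing σ) b hb) = b :=
    LinearMap.ext fun p => by simp [blockC_apply, coe_unipotentSp, unipotentσ_apply]
  have hD : blockD (unipotentSp (dotPairing σ) b hb) = LinearMap.id :=
    LinearMap.ext fun q => by simp [blockD_apply, coe_unipotentSp, unipotentσ_apply]
  refine ⟨?_, ?_, ?_, ?_⟩
  · rw [mA, hA, LinearMap.toMatrix'_id]
  · rw [mB, hB, map_zero]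
  · rw [mC, hC]
  · rw [mD, hD, LinearMap.toMatrix'_id]

/-- Blocks of a Weyl element `(p,q) ↦ (−q, p)`: `𝐀 = 𝐃 = 0`, `𝐁 = −1`, `𝐂 = 1`. [cite: Folland1989, §4.2 (4.26)] -/
theorem blocks_weyl (w : SpR σ) (hw : ∀ p q : σ → ℝ, (w.1 : (PV σ) ≃ₗ[ℝ] PV σ) (p, q) = (-q, p)) :
    mA w = 0 ∧ mB w = -1 ∧ mC w = 1 ∧ mD w = 0 := by
  refine ⟨?_, ?_, ?_, ?_⟩
  · exact eq_of_forall_mulVec_eq fun p => by rw [mA_mulVec, hw, neg_zero, Matrix.zero_mulVec]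
  · exact eq_of_forall_mulVec_eq fun q => by rw [mB_mulVec, hw, Matrix.neg_mulVec, Matrix.one_mulVec]
  · exact eq_of_forall_mulVec_eq fun p => by rw [mC_mulVec, hw, Matrix.one_mulVec]
  · exact eq_of_forall_mulVec_eq fun q => by rw [mD_mulVec, hw, Matrix.zero_mulVec]

/-- **`2·P(g) = (𝐀 + 𝐃) + i(𝐂 − 𝐁)`** in block-matrix form. [cite: Folland1989, §4.1 (4.11)–(4.16)] -/
theorem two_smul_follandP (g : SpR σ) :
    (2 : ℂ) • follandP g = (RC (mA g) + RC (mD g)) + I • (RC (mC g) - RC (mB g)) := by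
  rw [follandP, smul_smul, mul_inv_cancel₀ two_ne_zero, one_smul, map_add, map_sub, map_add, map_sub]
  rfl

/-! ### Complexified blocks -/

/-- `RC Mᵀ = (RC M)ᵀ`. [folklore] -/
private theorem RC_transpose (M : Matrix σ σ ℝ) : RC Mᵀ = (RC M)ᵀ := rfl

/-- `(RC M)ᴴ = (RC M)ᵀ` (real entries). [folklore] -/
private theorem RC_conjTranspose (M : Matrix σ σ ℝ) : (RC M)ᴴ = (RC M)ᵀ := by
  ext i j
  simp [Matrix.conjTranspose_apply, RingHom.mapMatrix_apply, Matrix.map_apply]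

/-- `𝐀ᵀ𝐂 = 𝐂ᵀ𝐀` over `ℂ`. [cite: Folland1989, §4.1 (4.2)] -/
theorem c_transpose_mA_mul_mC (g : SpR σ) : (RC (mA g))ᵀ * RC (mC g) = (RC (mC g))ᵀ * RC (mA g) := by
  rw [← RC_transpose, ← RC_transpose, ← map_mul, ← map_mul, transpose_mA_mul_mC]

/-- `𝐁ᵀ𝐃 = 𝐃ᵀ𝐁` over `ℂ`. [cite: Folland1989, §4.1 (4.2)] -/
theorem c_transpose_mB_mul_mD (g : SpR σ) : (RC (mB g))ᵀ * RC (mD g) = (RC (mD g))ᵀ * RC (mB g) := by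
  rw [← RC_transpose, ← RC_transpose, ← map_mul, ← map_mul, transpose_mB_mul_mD]

/-- `𝐀ᵀ𝐃 − 𝐂ᵀ𝐁 = 1` over `ℂ`. [cite: Folland1989, §4.1 (4.2)] -/
theorem c_transpose_mA_mul_mD_sub (g : SpR σ) : (RC (mA g))ᵀ * RC (mD g) - (RC (mC g))ᵀ * RC (mB g) = 1 := by
  rw [← RC_transpose, ← RC_transpose, ← map_mul, ← map_mul, ← map_sub, transpose_mA_mul_mD_sub, map_one]

/-- `𝐃ᵀ𝐀 − 𝐁ᵀ𝐂 = 1` over `ℂ`. [cite: Folland1989, §4.1 (4.2)] -/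
theorem c_transpose_mD_mul_mA_sub (g : SpR σ) : (RC (mD g))ᵀ * RC (mA g) - (RC (mB g))ᵀ * RC (mC g) = 1 := by
  rw [← RC_transpose, ← RC_transpose, ← map_mul, ← map_mul, ← map_sub, transpose_mD_mul_mA_sub, map_one]

end Sp

/-! ## 2. The Siegel upper half-space `𝔥_σ` -/

variable (σ) in
/-- **The Siegel upper half-space** `𝔥_σ = {τ ∈ M_σ(ℂ) : τᵀ = τ, Im τ ≻ 0}` (the parameter space of the Gaussians
`e^{πi x·τx} ∈ 𝓢(ℝ^σ)`). [cite: Folland1989, §4.5 (4.62); Siegel1943, §1] -/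
def siegelH : Set (Matrix σ σ ℂ) := {τ | τ.IsSymm ∧ (τ.map Complex.im).PosDef}

omit [Fintype σ] [DecidableEq σ] in
/-- Membership in `𝔥_σ`. [cite: Folland1989, §4.5 (4.62)] -/
theorem mem_siegelH {τ : Matrix σ σ ℂ} : τ ∈ siegelH σ ↔ τ.IsSymm ∧ (τ.map Complex.im).PosDef := Iff.rfl

omit [Fintype σ] in
/-- `Im (i·1) = 1`. [folklore] -/
private theorem map_im_I_smul_one : (I • (1 : Matrix σ σ ℂ)).map Complex.im = 1 := by
  ext i j
  by_cases h : i = j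
  · subst h; simp
  · simp [h]

omit [Fintype σ] in
/-- **The base point `i·1 ∈ 𝔥_σ`** (the parameter of the vacuum `k₀ = 2^{n/4} e^{−π|x|²}`). [cite: Folland1989, §4.5 (4.62)] -/
theorem I_smul_one_mem_siegelH : I • (1 : Matrix σ σ ℂ) ∈ siegelH σ := by
  refine ⟨?_, ?_⟩
  · show (I • (1 : Matrix σ σ ℂ))ᵀ = I • 1
    rw [Matrix.transpose_smul, Matrix.transpose_one]
  · rw [map_im_I_smul_one]
    exact Matrix.PosDef.one

/-- `Re ⟨v, Yv⟩ = ⟨Re v, Y Re v⟩ + ⟨Im v, Y Im v⟩` for a real matrix `Y` and a complex vector `v`. [folklore] -/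
private theorem re_star_dotProduct_RC_mulVec (Y : Matrix σ σ ℝ) (v : σ → ℂ) :
    (star v ⬝ᵥ ((RC Y) *ᵥ v)).re =
      (fun i => (v i).re) ⬝ᵥ (Y *ᵥ fun i => (v i).re) + (fun i => (v i).im) ⬝ᵥ (Y *ᵥ fun i => (v i).im) := by
  simp only [dotProduct, Matrix.mulVec, RingHom.mapMatrix_apply, Matrix.map_apply, Pi.star_apply,
    Finset.mul_sum, Complex.re_sum, ← Finset.sum_add_distrib]
  refine Finset.sum_congr rfl fun i _ => Finset.sum_congr rfl fun j _ => ?_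
  simp only [Complex.mul_re, Complex.mul_im, Complex.star_def, Complex.conj_re, Complex.conj_im,
    Complex.ofRealHom_eq_coe, Complex.ofReal_re, Complex.ofReal_im]
  ring

/-- `Im ⟨v, Yv⟩ = ⟨Re v, Y Im v⟩ − ⟨Im v, Y Re v⟩` for a real matrix `Y`. [folklore] -/
private theorem im_star_dotProduct_RC_mulVec (Y : Matrix σ σ ℝ) (v : σ → ℂ) :
    (star v ⬝ᵥ ((RC Y) *ᵥ v)).im =
      (fun i => (v i).re) ⬝ᵥ (Y *ᵥ fun i => (v i).im) - (fun i => (v i).im) ⬝ᵥ (Y *ᵥ fun i => (v i).re) := by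
  simp only [dotProduct, Matrix.mulVec, RingHom.mapMatrix_apply, Matrix.map_apply, Pi.star_apply,
    Finset.mul_sum, Complex.im_sum, ← Finset.sum_sub_distrib]
  refine Finset.sum_congr rfl fun i _ => Finset.sum_congr rfl fun j _ => ?_
  simp only [Complex.mul_im, Complex.mul_re, Complex.star_def, Complex.conj_re, Complex.conj_im,
    Complex.ofRealHom_eq_coe, Complex.ofReal_re, Complex.ofReal_im]
  ring

/-- **Real ⇒ complex positivity**: if `Y` is real symmetric positive definite then `RC Y` is a positive definite
complex (Hermitian) matrix (`𝔷̄ᵀY𝔷 > 0` for complex `𝔷 ≠ 0`, the form in which `Y = Im τ > 0` is used for complex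
vectors). [cite: Siegel1943, §2] -/
theorem posDef_RC {Y : Matrix σ σ ℝ} (hY : Y.PosDef) : (RC Y).PosDef := by
  have hYs : Y.IsSymm := by
    have h := hY.isHermitian
    rw [Matrix.IsHermitian, Matrix.conjTranspose_eq_transpose_of_trivial] at h
    exact h
  refine Matrix.PosDef.of_dotProduct_mulVec_pos ?_ fun v hv => ?_
  · show (RC Y)ᴴ = RC Y
    rw [Sp.RC_conjTranspose, ← Sp.RC_transpose, hYs.eq]
  · have hY' := (Matrix.posDef_iff_dotProduct_mulVec.1 hY).2
    rw [Complex.lt_def]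
    refine ⟨?_, ?_⟩
    · rw [Complex.zero_re, re_star_dotProduct_RC_mulVec]
      -- one of `Re v`, `Im v` is non-zero
      by_cases hre : (fun i => (v i).re) = 0
      · have him : (fun i => (v i).im) ≠ 0 := by
          intro him
          apply hv
          funext i
          exact Complex.ext (congrFun hre i) (congrFun him i)
        have h1 := hY' him
        rw [star_trivial] at h1
        rw [hre, zero_dotProduct, zero_add]
        exact h1
      · have h1 := hY' hre
        rw [star_trivial] at h1
        by_cases him : (fun i => (v i).im) = 0
        · rw [him, zero_dotProduct, add_zero]; exact h1
        · have h2 := hY' him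
          rw [star_trivial] at h2
          exact add_pos h1 h2
    · rw [Complex.zero_im, im_star_dotProduct_RC_mulVec, Matrix.dotProduct_mulVec (fun i => (v i).re) Y,
        ← Matrix.mulVec_transpose, hYs.eq, dotProduct_comm, sub_self]

/-- **Complex ⇒ real positivity**: if `Y` is real symmetric and `RC Y` is positive definite over `ℂ` then `Y` is
positive definite (restriction of `𝔷̄ᵀY𝔷 > 0` to real vectors). [cite: Siegel1943, §2] -/
theorem posDef_of_posDef_RC {Y : Matrix σ σ ℝ} (hYs : Y.IsSymm) (h : (RC Y).PosDef) : Y.PosDef := by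
  refine Matrix.PosDef.of_dotProduct_mulVec_pos ?_ fun u hu => ?_
  · show Yᴴ = Y
    rw [Matrix.conjTranspose_eq_transpose_of_trivial, hYs.eq]
  · have hu' : (fun i => ((u i : ℝ) : ℂ)) ≠ 0 := by
      intro h0; apply hu; funext i
      have := congrFun h0 i
      exact Complex.ofReal_eq_zero.1 this
    have h1 := h.dotProduct_mulVec_pos hu'
    rw [Complex.lt_def, Complex.zero_re, re_star_dotProduct_RC_mulVec] at h1
    have h2 := h1.1
    simp only [Complex.ofReal_re, Complex.ofReal_im] at h2
    have h0 : (fun i : σ => (0 : ℝ)) ⬝ᵥ (Y *ᵥ fun i : σ => (0 : ℝ)) = 0 := by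
      show (0 : σ → ℝ) ⬝ᵥ (Y *ᵥ 0) = 0
      rw [zero_dotProduct]
    rw [h0, add_zero] at h2
    rw [star_trivial]
    exact h2

/-- For `τ ∈ 𝔥_σ` the complexified imaginary part is positive definite. [cite: Folland1989, §4.5 (4.62)] -/
theorem posDef_RC_im {τ : Matrix σ σ ℂ} (hτ : τ ∈ siegelH σ) : (RC (τ.map Complex.im)).PosDef := posDef_RC hτ.2

/-- For symmetric `τ`: `τ − τ̄ = 2i · Im τ` (`τᴴ = τ̄` by symmetry). [cite: Siegel1943, §2] -/
theorem sub_conjTranspose_eq {τ : Matrix σ σ ℂ} (hτ : τ.IsSymm) : τ - τᴴ = ((2 : ℂ) * I) • RC (τ.map Complex.im) := by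
  ext i j
  rw [Matrix.sub_apply, Matrix.conjTranspose_apply, hτ.apply i j, Matrix.smul_apply, RingHom.mapMatrix_apply,
    Matrix.map_apply, Matrix.map_apply, Complex.star_def, Complex.sub_conj, smul_eq_mul, Complex.ofRealHom_eq_coe]
  push_cast
  ring

/-! ## 3. The action of `Sp(W)` on `𝔥_σ` induced by the Schrödinger-model generators -/

namespace Sp

/-- The denominator `𝐀 − 𝐁τ` of `g ⋆ τ` (the `Cτ + D` of `ᵗg⁻¹ = (𝐃 −𝐂; −𝐁 𝐀)`). [cite: Folland1989, §4.5 (4.64); Siegel1943, §2] -/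
def denom (g : SpR σ) (τ : Matrix σ σ ℂ) : Matrix σ σ ℂ := RC (mA g) - RC (mB g) * τ

/-- The numerator `𝐃τ − 𝐂` of `g ⋆ τ`. [cite: Folland1989, §4.5 (4.64); Siegel1943, §2] -/
def numer (g : SpR σ) (τ : Matrix σ σ ℂ) : Matrix σ σ ℂ := RC (mD g) * τ - RC (mC g)

/-- **The action `g ⋆ τ = (𝐃τ − 𝐂)(𝐀 − 𝐁τ)⁻¹`** of `Sp(W)` on `𝔥_σ` transported by the Schrödinger-model generators
(`n(b)`: `τ ↦ τ − b`; `m(a, ᵗa⁻¹)`: `τ ↦ ᵗa⁻¹ τ a⁻¹`; Fourier: `τ ↦ −τ⁻¹`) — the Möbius action of `ᵗg⁻¹`.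
[cite: Folland1989, §4.5 (4.64)–(4.65); Siegel1943, §2] -/
def sact (g : SpR σ) (τ : Matrix σ σ ℂ) : Matrix σ σ ℂ := numer g τ * (denom g τ)⁻¹

/-- **The automorphy factor `j(g, τ) = det(𝐀 − 𝐁τ)`.** [cite: Folland1989, §4.5 (4.65); Siegel1943, §2] -/
def sJ (g : SpR σ) (τ : Matrix σ σ ℂ) : ℂ := (denom g τ).det

/-- **The key identity** `(𝐀 − 𝐁τ)ᴴ(𝐃τ − 𝐂) − (𝐃τ − 𝐂)ᴴ(𝐀 − 𝐁τ) = τ − τᴴ` (from the three symplectic relations).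
[cite: Siegel1943, §2 (8)] -/
theorem conjTranspose_denom_mul_numer_sub (g : SpR σ) (τ : Matrix σ σ ℂ) :
    (denom g τ)ᴴ * numer g τ - (numer g τ)ᴴ * denom g τ = τ - τᴴ := by
  have e1 := c_transpose_mA_mul_mC g
  have e2 := c_transpose_mB_mul_mD g
  have e3 := c_transpose_mA_mul_mD_sub g
  have e3' := c_transpose_mD_mul_mA_sub g
  rw [denom, numer, Matrix.conjTranspose_sub, Matrix.conjTranspose_sub, Matrix.conjTranspose_mul,
    Matrix.conjTranspose_mul, RC_conjTranspose, RC_conjTranspose, RC_conjTranspose, RC_conjTranspose]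
  calc ((RC (mA g))ᵀ - τᴴ * (RC (mB g))ᵀ) * (RC (mD g) * τ - RC (mC g))
        - (τᴴ * (RC (mD g))ᵀ - (RC (mC g))ᵀ) * (RC (mA g) - RC (mB g) * τ)
      = ((RC (mA g))ᵀ * RC (mD g) - (RC (mC g))ᵀ * RC (mB g)) * τ
        - ((RC (mA g))ᵀ * RC (mC g) - (RC (mC g))ᵀ * RC (mA g))
        - τᴴ * ((RC (mB g))ᵀ * RC (mD g) - (RC (mD g))ᵀ * RC (mB g)) * τ
        - τᴴ * ((RC (mD g))ᵀ * RC (mA g) - (RC (mB g))ᵀ * RC (mC g)) := by noncomm_ring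
    _ = τ - τᴴ := by rw [e3, e1, e2, e3', sub_self, sub_self, Matrix.one_mul, sub_zero, Matrix.mul_zero,
        Matrix.zero_mul, sub_zero, Matrix.mul_one]

/-- The transposed identity `(𝐀 − 𝐁τ)ᵀ(𝐃τ − 𝐂) − (𝐃τ − 𝐂)ᵀ(𝐀 − 𝐁τ) = τ − τᵀ`. [cite: Siegel1943, §2 (7)] -/
theorem transpose_denom_mul_numer_sub (g : SpR σ) (τ : Matrix σ σ ℂ) :
    (denom g τ)ᵀ * numer g τ - (numer g τ)ᵀ * denom g τ = τ - τᵀ := by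
  have e1 := c_transpose_mA_mul_mC g
  have e2 := c_transpose_mB_mul_mD g
  have e3 := c_transpose_mA_mul_mD_sub g
  have e3' := c_transpose_mD_mul_mA_sub g
  rw [denom, numer, Matrix.transpose_sub, Matrix.transpose_sub, Matrix.transpose_mul, Matrix.transpose_mul]
  calc ((RC (mA g))ᵀ - τᵀ * (RC (mB g))ᵀ) * (RC (mD g) * τ - RC (mC g))
        - (τᵀ * (RC (mD g))ᵀ - (RC (mC g))ᵀ) * (RC (mA g) - RC (mB g) * τ)
      = ((RC (mA g))ᵀ * RC (mD g) - (RC (mC g))ᵀ * RC (mB g)) * τ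
        - ((RC (mA g))ᵀ * RC (mC g) - (RC (mC g))ᵀ * RC (mA g))
        - τᵀ * ((RC (mB g))ᵀ * RC (mD g) - (RC (mD g))ᵀ * RC (mB g)) * τ
        - τᵀ * ((RC (mD g))ᵀ * RC (mA g) - (RC (mB g))ᵀ * RC (mC g)) := by noncomm_ring
    _ = τ - τᵀ := by rw [e3, e1, e2, e3', sub_self, sub_self, Matrix.one_mul, sub_zero, Matrix.mul_zero,
        Matrix.zero_mul, sub_zero, Matrix.mul_one]

/-- **The denominator is invertible on `𝔥_σ`**: `det(𝐀 − 𝐁τ) ≠ 0` («`Cτ + D` is non-singular», via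
`v̄ᵀ(Im τ)v > 0`). [cite: Siegel1943, §2; Folland1989, §4.5 (4.64)] -/
theorem det_denom_ne_zero (g : SpR σ) {τ : Matrix σ σ ℂ} (hτ : τ ∈ siegelH σ) : (denom g τ).det ≠ 0 := by
  intro h0
  obtain ⟨v, hv, hMv⟩ := Matrix.exists_mulVec_eq_zero_iff.2 h0
  have key := congrArg (fun X : Matrix σ σ ℂ => star v ⬝ᵥ (X *ᵥ v)) (conjTranspose_denom_mul_numer_sub g τ)
  rw [Matrix.sub_mulVec, dotProduct_sub, ← Matrix.mulVec_mulVec, ← Matrix.mulVec_mulVec, hMv, Matrix.mulVec_zero,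
    dotProduct_zero, sub_zero, Matrix.dotProduct_mulVec, ← Matrix.star_mulVec, hMv, star_zero, zero_dotProduct,
    sub_conjTranspose_eq hτ.1, Matrix.smul_mulVec, dotProduct_smul, smul_eq_mul] at key
  have hpos := (posDef_RC_im hτ).dotProduct_mulVec_pos hv
  have hne : star v ⬝ᵥ (RC (τ.map Complex.im) *ᵥ v) ≠ 0 := ne_of_gt hpos
  have h2I : (2 : ℂ) * I ≠ 0 := mul_ne_zero two_ne_zero Complex.I_ne_zero
  exact mul_ne_zero h2I hne key.symm

/-- `IsUnit det(𝐀 − 𝐁τ)` on `𝔥_σ`. [cite: Siegel1943, §2] -/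
theorem isUnit_det_denom (g : SpR σ) {τ : Matrix σ σ ℂ} (hτ : τ ∈ siegelH σ) : IsUnit (denom g τ).det :=
  (det_denom_ne_zero g hτ).isUnit

/-- `j(g,τ) ≠ 0` on `𝔥_σ`. [cite: Siegel1943, §2] -/
theorem sJ_ne_zero (g : SpR σ) {τ : Matrix σ σ ℂ} (hτ : τ ∈ siegelH σ) : sJ g τ ≠ 0 := det_denom_ne_zero g hτ

/-- `(g ⋆ τ)(𝐀 − 𝐁τ) = 𝐃τ − 𝐂`. [cite: Siegel1943, §2] -/
theorem sact_mul_denom (g : SpR σ) {τ : Matrix σ σ ℂ} (hτ : τ ∈ siegelH σ) :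
    sact g τ * denom g τ = numer g τ := by
  rw [sact, Matrix.mul_assoc, Matrix.nonsing_inv_mul _ (isUnit_det_denom g hτ), Matrix.mul_one]

/-- **`g ⋆ τ` is symmetric** (from the transposed identity). [cite: Siegel1943, §2 (7)] -/
theorem isSymm_sact (g : SpR σ) {τ : Matrix σ σ ℂ} (hτ : τ ∈ siegelH σ) : (sact g τ).IsSymm := by
  have hU := isUnit_det_denom g hτ
  have hUT : IsUnit (denom g τ)ᵀ.det := by rwa [Matrix.det_transpose]
  have h0 : (denom g τ)ᵀ * numer g τ = (numer g τ)ᵀ * denom g τ := by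
    rw [← sub_eq_zero, transpose_denom_mul_numer_sub, hτ.1.eq, sub_self]
  -- `N M⁻¹ = M⁻ᵀ Nᵀ`
  have h1 : sact g τ = (denom g τ)ᵀ⁻¹ * (numer g τ)ᵀ := by
    have h2 : (denom g τ)ᵀ * sact g τ = (numer g τ)ᵀ := by
      rw [sact, ← Matrix.mul_assoc, h0, Matrix.mul_assoc, Matrix.mul_nonsing_inv _ hU, Matrix.mul_one]
    calc sact g τ = (denom g τ)ᵀ⁻¹ * ((denom g τ)ᵀ * sact g τ) := by
          rw [← Matrix.mul_assoc, Matrix.nonsing_inv_mul _ hUT, Matrix.one_mul]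
      _ = (denom g τ)ᵀ⁻¹ * (numer g τ)ᵀ := by rw [h2]
  show (sact g τ)ᵀ = sact g τ
  conv_lhs => rw [h1]
  rw [Matrix.transpose_mul, Matrix.transpose_transpose, ← Matrix.transpose_nonsing_inv, Matrix.transpose_transpose,
    sact]

/-- **Transformation of the imaginary part**: `Im(g ⋆ τ) = (𝐀 − 𝐁τ)⁻ᴴ (Im τ) (𝐀 − 𝐁τ)⁻¹`.
[cite: Siegel1943, §2 (9); Folland1989, §4.5 (4.64)] -/
theorem RC_im_sact (g : SpR σ) {τ : Matrix σ σ ℂ} (hτ : τ ∈ siegelH σ) :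
    RC ((sact g τ).map Complex.im) = (denom g τ)⁻¹ᴴ * RC (τ.map Complex.im) * (denom g τ)⁻¹ := by
  have hU := isUnit_det_denom g hτ
  have h2I : (2 : ℂ) * I ≠ 0 := mul_ne_zero two_ne_zero Complex.I_ne_zero
  -- `τ' − τ'ᴴ = M⁻ᴴ (Mᴴ N − Nᴴ M) M⁻¹`
  have key : sact g τ - (sact g τ)ᴴ = (denom g τ)⁻¹ᴴ * (τ - τᴴ) * (denom g τ)⁻¹ := by
    symm
    calc (denom g τ)⁻¹ᴴ * (τ - τᴴ) * (denom g τ)⁻¹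
        = (denom g τ)⁻¹ᴴ * ((denom g τ)ᴴ * numer g τ - (numer g τ)ᴴ * denom g τ) * (denom g τ)⁻¹ := by
          rw [conjTranspose_denom_mul_numer_sub]
      _ = ((denom g τ)⁻¹ᴴ * (denom g τ)ᴴ) * numer g τ * (denom g τ)⁻¹
          - (denom g τ)⁻¹ᴴ * (numer g τ)ᴴ * (denom g τ * (denom g τ)⁻¹) := by noncomm_ring
      _ = numer g τ * (denom g τ)⁻¹ - (denom g τ)⁻¹ᴴ * (numer g τ)ᴴ := by
          rw [← Matrix.conjTranspose_mul, Matrix.mul_nonsing_inv _ hU, Matrix.conjTranspose_one, Matrix.one_mul,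
            Matrix.mul_one]
      _ = sact g τ - (sact g τ)ᴴ := by rw [sact, Matrix.conjTranspose_mul]
  rw [sub_conjTranspose_eq hτ.1, sub_conjTranspose_eq (isSymm_sact g hτ), Matrix.mul_smul, Matrix.smul_mul] at key
  exact smul_right_injective (Matrix σ σ ℂ) h2I key

/-- **`Sp(W)` preserves `𝔥_σ`**: `g ⋆ τ ∈ 𝔥_σ`. [cite: Siegel1943, §2; Folland1989, §4.5 (4.64)] -/
theorem sact_mem (g : SpR σ) {τ : Matrix σ σ ℂ} (hτ : τ ∈ siegelH σ) : sact g τ ∈ siegelH σ := by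
  refine ⟨isSymm_sact g hτ, ?_⟩
  have hsymm : ((sact g τ).map Complex.im).IsSymm := (isSymm_sact g hτ).map _
  refine posDef_of_posDef_RC hsymm ?_
  rw [RC_im_sact g hτ]
  have hU := isUnit_det_denom g hτ
  have hinj : Function.Injective (denom g τ)⁻¹.mulVec :=
    Matrix.mulVec_injective_of_isUnit ((Matrix.isUnit_iff_isUnit_det _).2 (Matrix.isUnit_nonsing_inv_det _ hU))
  exact (posDef_RC_im hτ).conjTranspose_mul_mul_same hinj

/-! ### Products: the action composes and `j` is a cocycle -/

/-- Numerator of a product: `N_{gh}(τ) = 𝐃_g N_h(τ) − 𝐂_g M_h(τ)`. [cite: Siegel1943, §2] -/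
theorem numer_mul (g h : SpR σ) (τ : Matrix σ σ ℂ) :
    numer (g * h) τ = RC (mD g) * numer h τ - RC (mC g) * denom h τ := by
  rw [numer, numer, denom, mD_mul, mC_mul, map_add, map_add, map_mul, map_mul, map_mul, map_mul]
  noncomm_ring

/-- Denominator of a product: `M_{gh}(τ) = 𝐀_g M_h(τ) − 𝐁_g N_h(τ)`. [cite: Siegel1943, §2] -/
theorem denom_mul (g h : SpR σ) (τ : Matrix σ σ ℂ) :
    denom (g * h) τ = RC (mA g) * denom h τ - RC (mB g) * numer h τ := by
  rw [denom, denom, numer, mA_mul, mB_mul, map_add, map_add, map_mul, map_mul, map_mul, map_mul]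
  noncomm_ring

/-- `N_g(h ⋆ τ) = N_{gh}(τ) M_h(τ)⁻¹`. [cite: Siegel1943, §2] -/
theorem numer_sact (g h : SpR σ) {τ : Matrix σ σ ℂ} (hτ : τ ∈ siegelH σ) :
    numer g (sact h τ) = numer (g * h) τ * (denom h τ)⁻¹ := by
  rw [numer_mul, Matrix.sub_mul, Matrix.mul_assoc, Matrix.mul_assoc, Matrix.mul_nonsing_inv _ (isUnit_det_denom h hτ),
    Matrix.mul_one, numer, sact]

/-- `M_g(h ⋆ τ) = M_{gh}(τ) M_h(τ)⁻¹`. [cite: Siegel1943, §2] -/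
theorem denom_sact (g h : SpR σ) {τ : Matrix σ σ ℂ} (hτ : τ ∈ siegelH σ) :
    denom g (sact h τ) = denom (g * h) τ * (denom h τ)⁻¹ := by
  rw [denom_mul, Matrix.sub_mul, Matrix.mul_assoc, Matrix.mul_assoc, Matrix.mul_nonsing_inv _ (isUnit_det_denom h hτ),
    Matrix.mul_one, denom, sact]

/-- **The action composes**: `(gh) ⋆ τ = g ⋆ (h ⋆ τ)` on `𝔥_σ`. [cite: Siegel1943, §2; Folland1989, §4.5 (4.64)] -/
theorem sact_mul (g h : SpR σ) {τ : Matrix σ σ ℂ} (hτ : τ ∈ siegelH σ) : sact (g * h) τ = sact g (sact h τ) := by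
  have hU := isUnit_det_denom h hτ
  rw [sact, sact, numer_sact g h hτ, denom_sact g h hτ, Matrix.mul_inv_rev, Matrix.nonsing_inv_nonsing_inv _ hU,
    Matrix.mul_assoc, ← Matrix.mul_assoc ((denom h τ)⁻¹), Matrix.nonsing_inv_mul _ hU, Matrix.one_mul]

/-- **The cocycle identity** `j(gh, τ) = j(g, h ⋆ τ) · j(h, τ)`. [cite: Siegel1943, §2; Folland1989, §4.5 (4.65)] -/
theorem sJ_mul (g h : SpR σ) {τ : Matrix σ σ ℂ} (hτ : τ ∈ siegelH σ) : sJ (g * h) τ = sJ g (sact h τ) * sJ h τ := by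
  have hU := isUnit_det_denom h hτ
  rw [sJ, sJ, sJ, denom_sact g h hτ, Matrix.det_mul, mul_assoc, Matrix.det_nonsing_inv_mul_det _ hU, mul_one]

/-! ### Values on `1` and on the generators -/

/-- `M_1(τ) = 1`, `N_1(τ) = τ`. [cite: Siegel1943, §2] -/
theorem denom_one (τ : Matrix σ σ ℂ) : denom (1 : SpR σ) τ = 1 ∧ numer (1 : SpR σ) τ = τ := by
  rw [denom, numer, mA_one, mB_one, mC_one, mD_one, map_one, map_zero, Matrix.zero_mul, sub_zero,
    Matrix.one_mul, sub_zero]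
  exact ⟨rfl, rfl⟩

/-- `1 ⋆ τ = τ`, `j(1, τ) = 1` (the identity acts trivially). [cite: Siegel1943, §2] -/
theorem sact_one (τ : Matrix σ σ ℂ) : sact (1 : SpR σ) τ = τ ∧ sJ (1 : SpR σ) τ = 1 := by
  rw [sact, sJ, (denom_one τ).1, (denom_one τ).2, inv_one, Matrix.mul_one, Matrix.det_one]
  exact ⟨rfl, rfl⟩

/-- **Levi elements**: `m(a,d) ⋆ τ = d τ a⁻¹`, `j = det a` (`M = a`, `N = dτ`). [cite: Folland1989, §4.2 (4.24), §4.5 (4.65)] -/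
theorem sact_leviSp (a d : (σ → ℝ) ≃ₗ[ℝ] (σ → ℝ)) (had : ∀ x y, dotPairing σ (a x) (d y) = dotPairing σ x y)
    (τ : Matrix σ σ ℂ) :
    denom (leviSp (dotPairing σ) a d had) τ = RC (LinearMap.toMatrix' a.toLinearMap) ∧
      numer (leviSp (dotPairing σ) a d had) τ = RC (LinearMap.toMatrix' d.toLinearMap) * τ ∧
      sact (leviSp (dotPairing σ) a d had) τ =
        RC (LinearMap.toMatrix' d.toLinearMap) * τ * (RC (LinearMap.toMatrix' a.toLinearMap))⁻¹ ∧
      sJ (leviSp (dotPairing σ) a d had) τ = ((LinearMap.toMatrix' a.toLinearMap).det : ℂ) := by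
  obtain ⟨hA, hB, hC, hD⟩ := blocks_leviSp a d had
  have h1 : denom (leviSp (dotPairing σ) a d had) τ = RC (LinearMap.toMatrix' a.toLinearMap) := by
    rw [denom, hA, hB, map_zero, Matrix.zero_mul, sub_zero]
  have h2 : numer (leviSp (dotPairing σ) a d had) τ = RC (LinearMap.toMatrix' d.toLinearMap) * τ := by
    rw [numer, hC, hD, map_zero, sub_zero]
  refine ⟨h1, h2, by rw [sact, h1, h2], ?_⟩
  rw [sJ, h1, ← RingHom.map_det, Complex.ofRealHom_eq_coe]

/-- **Unipotents**: `n(b) ⋆ τ = τ − b`, `j = 1` (`M = 1`, `N = τ − b`). [cite: Folland1989, §4.2 (4.25), §4.5 (4.65)] -/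
theorem sact_unipotentSp (b : (σ → ℝ) →ₗ[ℝ] (σ → ℝ)) (hb : ∀ x x', dotPairing σ x (b x') = dotPairing σ x' (b x))
    (τ : Matrix σ σ ℂ) :
    denom (unipotentSp (dotPairing σ) b hb) τ = 1 ∧ numer (unipotentSp (dotPairing σ) b hb) τ = τ - RC (LinearMap.toMatrix' b) ∧
      sact (unipotentSp (dotPairing σ) b hb) τ = τ - RC (LinearMap.toMatrix' b) ∧ sJ (unipotentSp (dotPairing σ) b hb) τ = 1 := by
  obtain ⟨hA, hB, hC, hD⟩ := blocks_unipotentSp b hb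
  have h1 : denom (unipotentSp (dotPairing σ) b hb) τ = 1 := by
    rw [denom, hA, hB, map_zero, map_one, Matrix.zero_mul, sub_zero]
  have h2 : numer (unipotentSp (dotPairing σ) b hb) τ = τ - RC (LinearMap.toMatrix' b) := by
    rw [numer, hC, hD, map_one, Matrix.one_mul]
  refine ⟨h1, h2, ?_, ?_⟩
  · rw [sact, h1, h2, inv_one, Matrix.mul_one]
  · rw [sJ, h1, Matrix.det_one]

/-- **The Weyl element** `(p,q) ↦ (−q,p)` (realified `i·1`, the Fourier transform): `w ⋆ τ = −τ⁻¹`, `j = det τ`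
(`M = τ`, `N = −1`). [cite: Folland1989, §4.2 (4.26), §4.5 (4.65)] -/
theorem sact_weyl (w : SpR σ) (hw : ∀ p q : σ → ℝ, (w.1 : (PV σ) ≃ₗ[ℝ] PV σ) (p, q) = (-q, p)) (τ : Matrix σ σ ℂ) :
    denom w τ = τ ∧ numer w τ = -1 ∧ sact w τ = -τ⁻¹ ∧ sJ w τ = τ.det := by
  obtain ⟨hA, hB, hC, hD⟩ := blocks_weyl w hw
  have h1 : denom w τ = τ := by rw [denom, hA, hB, map_zero, map_neg, map_one, neg_mul, one_mul, zero_sub, neg_neg]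
  have h2 : numer w τ = -1 := by rw [numer, hC, hD, map_zero, map_one, Matrix.zero_mul, zero_sub]
  refine ⟨h1, h2, ?_, ?_⟩
  · rw [sact, h1, h2, neg_mul, one_mul]
  · rw [sJ, h1]

/-! ## 4. The link with Folland's `P`: `(1 − i(g ⋆ i))(𝐀 − i𝐁) = 2P(g)` -/

/-- **`(1 − i·(g ⋆ i1))(𝐀 − i𝐁) = 2 P(g)`** — at the base point `τ = i1` the Gaussian-orbit data recover
Folland's block `P = ½((𝐀+𝐃) + i(𝐂−𝐁))`. [cite: Folland1989, §4.1 (4.16), §4.5 (4.65)] -/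
theorem one_sub_I_smul_sact_mul_denom (g : SpR σ) :
    (1 - I • sact g (I • 1)) * denom g (I • 1) = (2 : ℂ) • follandP g := by
  rw [Matrix.sub_mul, Matrix.one_mul, Matrix.smul_mul, sact_mul_denom g I_smul_one_mem_siegelH, two_smul_follandP,
    denom, numer, Matrix.mul_smul, Matrix.mul_one, Matrix.mul_smul, Matrix.mul_one, smul_sub, smul_smul, I_mul_I,
    neg_one_smul, smul_sub]
  abel

/-- **`det(1 − i·(g ⋆ i1)) · j(g, i1) = 2ⁿ det P(g)`** — the bridge from the Gaussian cocycle to Folland's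
normalisation `C² det P = 1`. [cite: Folland1989, §4.1 (4.16), Thm. (4.37)] -/
theorem det_one_sub_I_sact_mul_sJ (g : SpR σ) :
    (1 - I • sact g (I • 1)).det * sJ g (I • 1) = (2 : ℂ) ^ Fintype.card σ * (follandP g).det := by
  rw [sJ, ← Matrix.det_mul, one_sub_I_smul_sact_mul_denom, Matrix.det_smul]

/-- `det P(g) ≠ 0` for every `g ∈ Sp(W)`. [cite: Folland1989, §4.1 Prop. (4.17)] -/
theorem follandP_det_ne_zero (g : SpR σ) : (follandP g).det ≠ 0 := by
  intro h0
  have h := det_one_sub_I_sact_mul_sJ g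
  rw [h0, mul_zero] at h
  have hτ' := sact_mem g (I_smul_one_mem_siegelH (σ := σ))
  -- `det(1 − iτ') ≠ 0`: `1 − iτ' = −i (τ' + i)` and `τ' + i ∈ 𝔥`... we use the unipotent trick: `1 − iτ' = M_w(τ'')`-free argument:
  -- `(1 − iτ') v = 0 ⇒ v̄ᵀ(1 − iτ')v = 0 ⇒ |v|² + v̄ᵀ(Im τ')v − i v̄ᵀ(Re τ')v = 0`, real part `> 0`.
  rcases mul_eq_zero.1 h with h1 | h1
  · obtain ⟨v, hv, hMv⟩ := Matrix.exists_mulVec_eq_zero_iff.2 h1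
    have hre : (star v ⬝ᵥ ((1 - I • sact g (I • 1)) *ᵥ v)).re =
        (star v ⬝ᵥ v).re + (star v ⬝ᵥ (RC ((sact g (I • 1)).map Complex.im) *ᵥ v)).re := by
      have hdec : (1 - I • sact g (I • 1)) = 1 + RC ((sact g (I • 1)).map Complex.im)
          - I • RC ((sact g (I • 1)).map Complex.re) := by
        ext i j
        rw [Matrix.sub_apply, Matrix.sub_apply, Matrix.add_apply, Matrix.smul_apply, Matrix.smul_apply,
          RingHom.mapMatrix_apply, RingHom.mapMatrix_apply, Matrix.map_apply, Matrix.map_apply, Matrix.map_apply,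
          Matrix.map_apply, smul_eq_mul, smul_eq_mul, Complex.ofRealHom_eq_coe]
        apply Complex.ext <;> simp
      rw [hdec, Matrix.sub_mulVec, Matrix.add_mulVec, dotProduct_sub, dotProduct_add, Matrix.one_mulVec,
        Complex.sub_re, Complex.add_re, Matrix.smul_mulVec, dotProduct_smul, smul_eq_mul]
      have him : (star v ⬝ᵥ (RC ((sact g (I • 1)).map Complex.re) *ᵥ v)).im = 0 := by
        rw [im_star_dotProduct_RC_mulVec, Matrix.dotProduct_mulVec (fun i => (v i).re), ← Matrix.mulVec_transpose,
          ((isSymm_sact g I_smul_one_mem_siegelH).map Complex.re).eq, dotProduct_comm, sub_self]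
      rw [Complex.I_mul_re, him, neg_zero, sub_zero]
    rw [hMv, dotProduct_zero, Complex.zero_re] at hre
    have h1 : 0 < (star v ⬝ᵥ v).re := by
      have : star v ⬝ᵥ v = star v ⬝ᵥ ((RC (1 : Matrix σ σ ℝ)) *ᵥ v) := by rw [map_one, Matrix.one_mulVec]
      rw [this]
      exact (Complex.lt_def.1 ((posDef_RC Matrix.PosDef.one).dotProduct_mulVec_pos hv)).1
    have h2 : 0 < (star v ⬝ᵥ (RC ((sact g (I • 1)).map Complex.im) *ᵥ v)).re :=
      (Complex.lt_def.1 ((posDef_RC_im hτ').dotProduct_mulVec_pos hv)).1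
    linarith
  · exact sJ_ne_zero g I_smul_one_mem_siegelH h1

end Sp

end Literature.NumberTheory.Weil1964
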